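import Mathlib
import HarnessLib
import HarnessLib.Audit
import Summits.AtomisticToContinuum.Statement
import Literature.MathematicalPhysics.QuantumManyBody.PeriodicBoseGas
import Literature.Barriers.AtomisticToContinuum.KineticGapLengthScales
import HarnessLib.Audit.Status.Attr

/-!
Route: BECIntegerBlockRotor

# Route BECIntegerBlockRotor — reflection positivity regained after blocking — integer-filled
healing-length blocks inherit the proved quantum-rotor infrared bound

Conforming re-open (D-0027 §2.1) of the retired route BECBlockRotorRP for card
integer-block-rotor-rp, REFLECTION POSITIVITY
REGAINED AFTER BLOCKING, with three changes: (a) the deciding theorem `closes` concludes the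
Statement decl `_root_.BoseEinsteinCondensation`
by name (sorry-free, Sketch.lean rc 0); (b) every item is re-typed BOX-UNIFORMLY (all dilute
periodic boxes (N, L), block window measured in the
box's own density N/L³) so that the implications between items are usable by their provers; (c) the
filling transfer is re-factored into the
crisp crux FillingContinuity (quasi-monotonicity of the ground-state condensate number in N on a
fixed torus) plus provable glue.
It suffices to show X = FamilyBEC (item Target): there are a block constant A, a density ρ₀, c > 0
and N₀ such that on EVERY periodic box
(N ≥ N₀ particles, side L, N ≤ ρ₀L³) that admits an even K with K³ ∣ N and block side L/K ∈ [A,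
2A]·(N/L³)^(-1/2) (INTEGER block filling
m = N/K³ at healing-length block side), the ground-state constant-mode occupation
`periodicCondensateNumber v N L` is ≥ cN. X is what the
card's engine reaches: BlockSusceptibilityBound (#2, Gaussian domination inherited from the
quantum-rotor array, whose ground-state
reflection-positivity / infrared-bound / long-range-order theory is now PROVED in tree:
`QuantumRotor.KleinPerez1992_rotorGroundStateLRO_holds`,
`QuantumRotorTruncatedGD/Infrared/SumRule`) ⇒ BlockInfraredBound (#3, support KLSTransfer) which
with BlockCondensation (#5, the ultraviolet
half on proved LSSY facts) gives X by Parseval over the K³ block modes (support BlockModeCounting).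
X → conjunct: FillingContinuity (#4) and the
arithmetic glue FamilyToPeriodic give PeriodicBEC for all large N (the exact antecedent of the
shared crux BoundaryTransferWeak, stmt-0827, #6),
which gives HasGroundStateBEC, i.e. the conjunct.
Lean: `∀ v : ℝ → ENNReal,
Literature.MathematicalPhysics.QuantumManyBody.BoseGas.IsRepulsiveFiniteRange v → ∃ A : ℝ, 0 < A ∧ ∃
ρ₀ : ℝ, 0 < ρ₀ ∧ ∃ c : ℝ, 0 < c ∧ ∃ N₀ : ℕ, ∀ (N : ℕ) (L : ℝ), 0 < L → N₀ ≤ N → (N : ℝ) ≤ ρ₀ * L ^ 3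
→ (∃ K : ℕ, Even K ∧ 0 < K ∧ K ^ 3 ∣ N ∧ A / Real.sqrt ((N : ℝ) / L ^ 3) ≤ L / (K : ℝ) ∧ L / (K : ℝ)
≤ 2 * A / Real.sqrt ((N : ℝ) / L ^ 3)) → ENNReal.ofReal (c * N) ≤
Literature.Barriers.AtomisticToContinuum.BoseGas.periodicCondensateNumber v N L`

## Assembly
DECIDING THEOREM (glue.lean, sorry-free, axioms propext/Classical.choice/Quot.sound in Sketch.lean):
`theorem closes (hMC : BlockModeCounting)
(hIR : BlockInfraredBound) (hBC : BlockCondensation) (hFC : FillingContinuity) (hFP :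
FamilyToPeriodic) (hBT : BoundaryTransferWeak) :
_root_.BoseEinsteinCondensation := fun v hv => hBT v hv (hFP (hMC hIR hBC) hFC v hv)` — pure modus
ponens: mode counting turns #3 and #5 into
the target X, FamilyToPeriodic with #4 turns X into PeriodicBEC(v), the shared #6 turns that into
∃ρ₀ ∀ρ<ρ₀ HasGroundStateBEC v ρ, which is the
conjunct unfolded at v. BlockSusceptibilityBound and KLSTransfer feed #3 and are not hypotheses of
`closes` (the IR bound is asked "by any
method"); FamilyBEC is what the chain reaches (target), not a hypothesis.

Rationale: WHY THIS LINE. The only thermodynamic-limit proofs of continuous-symmetry breaking for quantum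
many-body systems are reflection positivity (RP) + infrared bounds (FrohlichSimonSpencer1976,
DysonLiebSimon1978; T = 0: KLS1988PRL, KLS1988JSP; hard-core bosons at half filling AizenmanEtAl2004
= LSSY2005 Ch. 11; quantum rotors DriesslerLandauPerez1979, PasturKhoruzhenko1987, Wojtkiewicz2012,
WojtkiewiczPuszStachura2016 Thm 3.3 — the last now a proved Literature fact,
`KleinPerez1992_rotorGroundStateLRO_holds`). The continuum gas is not RP and lattice bosons are RP
only at the particle–hole symmetric point; WojtkiewiczPuszStachura2016 p. 14 name the obstruction
exactly: in number–phase variables the Bose–Hubbard Hamiltonian is the rotor Hamiltonian "plus one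
term more" (the √(n n′) amplitude / offset-charge term) which "spoils the Reflection Positivity",
and call extending RP past it "the long-standing and important problem". The card's twist makes that
spoiler PARAMETRICALLY SMALL and puts the symmetric point where we want it: cut the torus into K³
Anderson blocks (doi:10.1103/revmodphys.38.298, FisherEtAl1989) of healing-length side l = L/K ∈ [A,
2A]ρ^(-1/2) — inside the window where intra-block condensation is proved technology (LSSY2005 Thm
5.1, Fournais2020, Junge2026, ChongLiangNam2026) — and choose K so that the block filling m = N/K³ =
ρl³ ~ A³ρ^(-1/2) is an INTEGER: the block number–phase model U Σ(n_B − m)² − J Σ cos(θ_B − θ_B′) is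
then reflection positive through block planes EXACTLY (conjugation n_B ↦ 2m − n_B; cos⊗cos + sin⊗sin
is the KLS real form; J/U ~ ρl⁴/a ≫ 16, the tree's proved rotor threshold), while the RP-spoiling
corrections (√n amplitudes, the floor n ≥ 0, non-quadratic charging, longer-range Schur-complement
couplings) have relative size O(m^(-1/2)) + O((ξ/l)²) → 0 as ρ → 0 at fixed A. Imported: lattice RP
/ Gaussian domination / KLS T = 0 transfer (statistical mechanics) for the INFRARED half;
LSSY–Fournais energy localisation (in tree: LSSY2005_lowerBound_periodic/_dirichlet,
LSSY2005_upperBound_periodic, Fournais2020_condensation) for the ULTRAVIOLET half; they meet at ONE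
block scale. What no other route does: BECInfraredBound files the continuum IR bound as a black-box
crux (Dirichlet, no mechanism); BECChargeConjugationRP puts the RP point at the relativistic
C-symmetric vacuum and dials away from it; BECStoquasticCensoring eliminates configurations instead
of modes; here RP acts on the physical gas's own block variables at a symmetric point we can DIAL
INTO by the free choice of l. Negatives index (6 entries, 1 BEC: SwapJensen stmt-3980) not touched.

RANKED CRUXES. #0 FamilyBEC (target) — BEC ALONG THE INTEGER-FILLED FAMILY, box-uniform: for every
repulsive finite-range v there are A, ρ₀, c > 0 and N₀ such that for every N ≥ N₀ and every torus
side L > 0 with N ≤ ρ₀L³, if some even K > 0 has K³ ∣ N and A/√(N/L³) ≤ L/K ≤ 2A/√(N/L³), then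
ofReal(cN) ≤ periodicCondensateNumber v N L (ground-state constant-mode occupation through
near-minimisers, Literature.Barriers.AtomisticToContinuum.BoseGas). Vacuous on boxes with no
admissible K (e.g. N prime) by design; FillingContinuity + FamilyToPeriodic upgrade it to all large
N. (why it might fail: False only if torus ground states at commensurate (N, L) fail to condense,
i.e. if periodic BEC itself fails in the dilute regime; c uniform in ρ < ρ₀ is the KLS mode-counting
shape (depletion into block waves ≤ C·I·√ρ₀·A⁻³·N).) [LSSY2005, KLS1988PRL, Fournais2020,
WojtkiewiczPuszStachura2016]
#2 BlockSusceptibilityBound (crux) — GAUSSIAN DOMINATION FOR THE BLOCKED GAS (card item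
"StateReduction", energy form; the inter-block engine). There are ρ₀, A, C, N₀: for every box (N+1 ≤
ρ₀L³, N ≥ N₀), some δ > 0, every δ-near-minimiser Ψ of the periodic (N+1)-body energy, every even K
> 0 with K³ ∣ N+1 and A/√((N+1)/L³) ≤ L/K ≤ 2A/√((N+1)/L³), and every q ∈ ℤ³ with q ≢ 0 mod K: b₋(q)
+ b₊(q) ≤ C (L/K)²/ε(q), ε(q) = Σ_j (1 − cos(2πq_j/K)), where b₋ = sup over N-particle Φ of |⟨Φ,
a(f_q)Ψ⟩|²/(E(Φ) − E₀(N) + θ), b₊ = sup over (N+2)-particle Φ of |⟨a(f_q)Φ, Ψ⟩|²/(E(Φ) − E₀(N+2) +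
θ) (the two-sided static susceptibility of a(f_q) + a(f_q)*, = the resolvent expectations by
Cauchy–Schwarz), f_q(x) = L^(-3/2) exp(2πi q·⌊Kx/L⌋/K) the block plane wave, θ = ε(q)/(L/K)² a
harmless regulariser; Bogoliubov value ≈ l²/(3ε(q)), free gas exactly l²·Σ_k|f̂_q(k)|²/(k²l²+ε(q)) ≤
l²/ε(q). MECHANISM: exact RP/GD of the integer-filled block rotor array (in tree:
QuantumRotorTruncatedGD, Matrix.kls_groundEnergy_reflection) + stability under the RP-spoiling
corrections. [difficulty: open-problem] (why it might fail: GD is exact-or-nothing (Speer1985): the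
blocked gas is the RP rotor array plus WPS2016's RP-spoiling term (√n amplitudes, floor n≥0,
non-quadratic charging, Schur-complement couplings), small (O(m^-1/2)+(ξ/l)²) but no perturbative
stability of GD is known.) [KLS1988JSP, DysonLiebSimon1978, WojtkiewiczPuszStachura2016,
FisherEtAl1989, PasturKhoruzhenko1987, DriesslerLandauPerez1979, Speer1985]
#3 BlockInfraredBound (crux) — T = 0 INFRARED BOUND FOR BLOCK PLANE WAVES (Kennedy–Lieb–Shastry
shape), box-uniform: there are ρ₀, A, C, N₀ such that for every box (N ≥ N₀, N ≤ ρ₀L³), some δ > 0,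
every periodic δ-near-minimiser Ψ, every even K > 0 with K³ ∣ N and A/√(N/L³) ≤ L/K ≤ 2A/√(N/L³),
and every q ≢ 0 mod K: ⟨f_q, γ_Ψ f_q⟩ = cellOccupation N L f_q Ψ ≤ C/√ε(q). Only the K³ coarse modes
are constrained (the low-momentum half); Bogoliubov predicts c₀(l/ξ)/√ε(q) + O(1) aliasing, l/ξ
constant in ρ at fixed A. From #2 by the KLS transfer (support KLSTransfer) or by any method. [deps:
BlockSusceptibilityBound] [difficulty: open-problem] (why it might fail: Only if phase stiffness
fails at the healing scale (susceptibility ≫ l²/ε(q), an anomalously soft non-phonon branch); as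
typed C must be uniform over all dilute boxes, K ≥ 2, hard cores, and absorb the O(1) aliasing of
sharp block waves.) [KLS1988PRL, KLS1988JSP, LSSY2005, BjornbergUeltschi2022,
WojtkiewiczPuszStachura2016]
#4 FillingContinuity (crux) — QUASI-MONOTONICITY OF THE CONDENSATE IN THE PARTICLE NUMBER ON A FIXED
TORUS (replaces gen-1 FillingRemainder; the doping step every RP mechanism needs, since RP reaches
only conjugation-charge-0 sectors, rp_oddCharge_eq_zero): for every repulsive finite-range v there
are C ≥ 0 and ρ₁ > 0 such that for all N′ ≤ N and L > 0 with N ≤ ρ₁L³: periodicCondensateNumber v N′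
L ≤ periodicCondensateNumber v N L + C(N − N′) — adding a particle to a dilute periodic box removes
at most C particles from the ground-state condensate (Bogoliubov: it ADDS 1 − O(√(ρa³))). Weaker
than BEC (true when nothing condenses), mechanism-free, box-uniform; the impurity/induction
technology of card one-particle-at-a-time (MysliwySeiringer2020-type dressing, retired route
BECParticleInduction's IncrementBound is the Dirichlet '+1/2' strengthening) is the foreseen engine.
[difficulty: open-problem] (why it might fail: A ground-state-to-ground-state comparison across N
with no variational handle: energy slack (N−N′)·8πaρ ≫ N/L² rules out energy proofs (Galilei boost),
GD is lost off charge 0, and C uniform down to N′ ~ 1, L ≫ healing length includes the polaron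
regime.) [LSSY2005, KLS1988JSP, MysliwySeiringer2020, AizenmanEtAl2004,
Literature.Barriers.AtomisticToContinuum.KineticGapLengthScalesNarrow]
#5 BlockCondensation (crux) — INTRA-BLOCK BEC SUMMED OVER BLOCKS (the ultraviolet half; sum-rule
side of KLS), box-uniform and with NO integer-filling hypothesis: for every A > 0 and η > 0 there
are ρ₀, N₀ such that for every box (N ≥ N₀, N ≤ ρ₀L³), some δ > 0, every periodic δ-near-minimiser Ψ
and every even K > 0 with A/√(N/L³) ≤ L/K ≤ 2A/√(N/L³): Σ_B ⟨u_B, γ_Ψ u_B⟩ ≥ (1 − η)N for the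
normalised block indicators u_B = (L/K)^(-3/2) 1_(⌊Kx/L⌋ = B). Route to proof, inputs PROVED in
tree: Neumann bracketing of the torus into K³ blocks (v ≥ 0 drops cross pairs), per-block LSSY Thm
2.4 lower bound with capping for under/over-filled blocks, global Thm 2.2 upper bound, Jensen on Σ
n_B², and the gap step of LSSY Lemma 5.2 inside each block: depletion ≤ C A² a (Y^(1/17) + a/b) N →
0 at fixed A. [difficulty: L] (why it might fail: Thm 2.4's per-block hypotheses (Y_B < δ, l/a >
C′Y_B^(-6/17)) fail for under/over-filled blocks (capping + monotonicity of E^Neu in n needed); δ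
must serve all K in the window at once; hard cores v = ⊤; K = 2 boxes.) [LSSY2005, Fournais2020,
Junge2026, ChongLiangNam2026]
#6 BoundaryTransferWeak (crux) — SHARED ITEM stmt-AtomisticToContinuum-0827 (verbatim signature;
home the retired BECPeriodicReduction, wanted by BECChargeConjugationRP and others): for each
repulsive finite-range v, PeriodicBEC(v) (all large N, near-minimiser form, constant mode) implies
∃ρ₀ > 0 ∀ρ ∈ (0, ρ₀) HasGroundStateBEC v ρ (Dirichlet ground state, λ_max ≥ cN). [difficulty:
open-problem] (why it might fail: PeriodicBEC is ground-state-only (δ after N): the Dirichlet ground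
state is a periodic trial state but lies a wall term ≫ δ above E₀^per, interior restrictions are
neither periodic nor of sharp N; BEC is BC-sensitive (Robinson1976).) [LSSY2005, Robinson1976,
Junge2026, stmt-AtomisticToContinuum-0827]
#9 KLSTransfer (support) — BlockSusceptibilityBound → BlockInfraredBound, the canonical fixed-N
Kennedy–Lieb–Shastry transfer: 2n(f) + 1 = ‖a(f)Ψ‖² + ‖a(f)*Ψ‖² ≤ √((b₋ + b₊)(c₋ + c₊)) (spectral
Cauchy–Schwarz with sector-wise reference energies E₀(N∓1)), c = double commutator ⟨[a(f)*, [H,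
a(f)]]⟩ ≤ ⟨f, −Δf⟩ + interaction part + concavity defect (2E₀(N) − E₀(N−1) − E₀(N+1))₊ ≤ c√(ρ/a)
(trivial for integrable v via the constant one-particle trial state, Jastrow insertion for hard
cores). Sharp block waves have ⟨f, −Δf⟩ = ∞: smooth at relative scale s (cost 1/s in c) and return
to the sharp wave through translation invariance of near-ground states (γ diagonal in plane waves,
n(f) = Σ_k |f̂(k)|² n_k; layer mode of norm² ~ s); regulariser θ = ε(q)/l² costs O(1) per mode ≪ m.
Apply #2 with its N := N − 1. [difficulty: L] [KLS1988JSP, KLS1988PRL, LSSY2005]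
#9 BlockModeCounting (support) — BlockInfraredBound → BlockCondensation → FamilyBEC (mode counting,
the d = 3 step): with A, C from #3 and η = 1/4 in #5: (i) Parseval on the K³-dimensional span of the
block indicators, Σ_(q mod K) n(f_q) = Σ_B n(u_B) (f_q = K^(-3/2) Σ_B e^(2πiq·B/K) u_B is an
orthonormal basis; occupation is a quadratic form in the mode, Fubini); (ii) f_0·1_cell =
constantMode L, so n(f_0) = condensateOccupation; (iii) Σ_(q≠0) n(f_q) ≤ C K³ I, I = sup_K K^(-3)
Σ_(q≠0) ε(q)^(-1/2) < ∞ (Riemann sum of (2π)^(-3)∫dq ε^(-1/2), the WPS2016 constant 𝓘₃ ≈ 0.644; cf.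
in-tree klsRiemannSum facts); (iv) K³ = N/m ≤ N√(N/L³)/A³ ≤ √ρ₀ N/A³, so Σ_(q≠0) ≤ N/4 once ρ₀ ≤
(A³/4CI)²; hence n(f_0) ≥ N/2 on δ-near-minimisers (δ = min of the two), and
le_periodicCondensateNumber gives FamilyBEC with c = 1/2, N₀ = max; (v) ENNReal bookkeeping.
[difficulty: M] [KLS1988PRL, LSSY2005, WojtkiewiczPuszStachura2016]
#9 FamilyToPeriodic (support) — FamilyBEC → FillingContinuity → PeriodicBEC for every repulsive
finite-range v (the exact antecedent of BoundaryTransferWeak): given v take (A, ρ₀ᶠ, c, N₀) and (C,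
ρ₁); for ρ < ρ₀ := min(ρ₀ᶠ, ρ₁, ρ*) and large N put L = (N/ρ)^(1/3), pick an even K in [L√ρ/(1.8A),
L√ρ/(1.2A)] (length ≥ 2 for large N) and N′ := K³⌊N/K³⌋: then K³ ∣ N′, N − N′ < K³ ≤ √ρ N/(1.728A³),
N′/L³ ∈ [0.99ρ, ρ] so A/√(N′/L³) ≤ L/K ≤ 2A/√(N′/L³); FamilyBEC gives ofReal(cN′) ≤ PCN(N′, L),
FillingContinuity gives PCN(N′, L) ≤ PCN(N, L) + ofReal(C(N − N′)) with C(N − N′) ≤ cN′/2 once m′ =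
N′/K³ ≥ 1.728A³/√ρ − 1 ≥ 2C/c (this fixes ρ*); so PCN(N, L) ≥ ofReal(cN/4) > ofReal(cN/8) and
lt_iSup_iff unpacks periodicCondensateNumber into ∃δ > 0 ∀Ψ δ-near-minimiser, ofReal((c/8)N) ≤
condensateOccupation. Real arithmetic (floor, rpow, even integer in an interval of length ≥ 2) +
ENNReal; provable now. [difficulty: provable-now] [LSSY2005,
Literature.Barriers.AtomisticToContinuum.KineticGapLengthScales]

TWO-LAYER PLAN. Foreseen glued splits (k ≤ 3, depth 1; nothing filed now). BlockSusceptibilityBound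
⇐ RotorSectorGD (exact T = 0 Gaussian domination for the integer-filled, momentum-truncated block
number–phase array — the in-tree QuantumRotorTruncatedGD pattern with charging offset m, provable
now) → SpoilerStability (GD for the blocked gas from GD of the array: control of the RP-spoiling
corrections of relative size O(m^(-1/2)) + O((ξ/l)²) on the susceptibility, not on the energy) →
BlockSusceptibilityBound. BlockCondensation ⇐ NeumannBlockBracketing → PerBlockGapStep →
BlockCondensation. FillingContinuity ⇐ OneParticleStep (N′ → N′+1 with loss C, impurity form) →
telescoping. If #2 dies but #3 stands, #3 is re-sourced (sibling engines: synchronisation / duality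
cards) without touching the rest of the chain.

KILL CRITERIA. A proof that dilute torus near-minimisers at integer block filling violate
BlockInfraredBound at |q| ~ 1 by a divergent factor (phase susceptibility ≫ l²/ε(q): vanishing
stiffness at the healing scale) refutes #2 and #3 and closes the route `refuted:BlockInfraredBound`.
¬BlockSusceptibilityBound with #3 standing kills the RP mechanism only: supersede by
BECInfraredBound (the IR bound as a black box) unless a sibling engine re-sources #3.
¬FillingContinuity (a dilute box where adding N − N′ particles destroys ω(1)·(N − N′) condensate)
forces a pivot: Target restricted to the commensurate family + a Dirichlet transfer stated on that
family (new item), FamilyToPeriodic dropped. ¬BlockCondensation as typed ⇒ re-type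
window/quantifiers (class misstated, no kill). ¬BoundaryTransferWeak kills every periodic route, not
only this one. PeriodicBEC (stmt-0826 body) proved elsewhere moots #2–#5; the conjunct proved
elsewhere moots the route.

NOT DECOMPOSED YET. The exact RP rewriting of the blocked gas and the size of the spoiler (children
of #2); the KLS transfer internals beyond the support item (smoothing scale s, sector reference
energies, hard-core Jastrow insertion); the capping/monotonicity lemma for under/over-filled Neumann
blocks (child of #5); the one-particle step of #4; constants A, C, ρ₀; T > 0 and grand-canonical
variants; the Dirichlet transfer (shared #6, its home line's business).

CHEAPEST FALSIFIER. (i) Free gas v ≡ 0, checked by hand at filing: all ten items hold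
(near-minimisers are the constant state; b₋ = 0 and b₊ = l² Σ_k |f̂_q(k)|²/(k²l² + ε(q)) ≤ l²/ε(q),
so #2 holds with C = 1; PCN(N′) = N′ ≤ N = PCN(N) for #4; Σ_B n(u_B) = N for #5). (ii) The two-block
Bogoliubov test of the RP mechanism (refuters first): two Neumann boxes of side l = Aρ^(-1/2) at
integer filling m coupled through a face — expand the exact low-energy coupling in block
number–phase variables and measure the conjugation-odd part (the WPS2016 spoiler) against the
precision l²/ε(q) that #2 needs; if it is O(1) relative rather than O(m^(-1/2)), SpoilerStability is
dead and #2 survives only "by any method". (iii) #4 against Bogoliubov on a fixed torus: dn₀/dN = 1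
− (4/√π)√(ρa³)(1 + o(1)) > 0 — consistent; a rigorous counterexample would have to be
non-perturbative.

NUMBERS. Rotor threshold proved in tree: J/h > 16 (`KleinPerez1992_rotorGroundStateLRO_holds`; in
print 𝓘₃² ≈ 0.415, WojtkiewiczPuszStachura2016 Thm 3.3); blocked gas: U = 8πa/l³ (charging, from
e(n) ≈ 4πa n²/l³), J = 2c·m/l² (coarse Dirichlet form), so J/U = c·m·l/(4πa) = c·ρl⁴/(4πa) ~ A⁴/(aρ)
→ ∞. Block filling m = ρl³ ∈ [A³, 8A³]·ρ^(-1/2); blocks K³ = N/m ≤ √ρ N/A³; remainder N − N′ < K³.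
Bogoliubov: n(f_q) ≈ c₀(l/ξ)/√ε(q), l/ξ = A√(8πa)·O(1); two-sided susceptibility ≈ l²/(3ε(q));
depletion into block waves ≈ (ρa³)^(1/2)(ξ/l)² × I × N, I = (2π)⁻³∫d³q ε(q)^(-1/2) ≈ 0.644;
intra-block depletion ≤ C A² a (Y^(1/17) + a/b) N, Y = 4πρa³/3. Twist scale N/L² = N^(1/3)ρ^(2/3)
versus remainder slack (N − N′)·8πaρ ~ N ρ^(3/2)/A³ — why #4 cannot be an energy lemma
(KineticGapLengthScalesNarrow: a window > 4π²N/L² certifies at most N/2). Items at open: 10 (1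
target, 5 cruxes, 3 support, 1 assembly). CONE (route-repair
rrepair-AtomisticToContinuum-BECIntege-fddf6788, 2026-08-15): the route file imports, besides the
auto-import Summits.AtomisticToContinuum.Statement, only QuantumManyBody.PeriodicBoseGas and
Barriers.AtomisticToContinuum.KineticGapLengthScales (both needed:
PeriodicTrialState/periodicEnergy/cellOccupation/condensateOccupation and periodicCondensateNumber;
every named fact they carry is PROVED in tree — Fournais2020_condensation_holds,
LSSY2005_lowerBound_periodic_holds, LSSY2005_lowerBound_dirichlet_holds,
LSSY2005_upperBound_periodic_holds, LSSY2005_thm51_periodic_holds, KineticGapLengthScales_holds);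
gate view: deciding theorem OK (authority native), 0 unproved of 40 project constants, staffable.
needs-fact: NONE — the 4 unproved named facts a module-cone census finds (63 binder-less Prop facts
in the 14-file Literature cone, 59 discharged) are the summit's four OPEN conjunct statements
Literature.MathematicalPhysics.KineticTheory.HydrodynamicLimit,
Literature.MathematicalPhysics.KineticTheory.HeatConduction.FouriersLaw,
Literature.MathematicalPhysics.StatisticalMechanics.Crystallization and
Literature.MathematicalPhysics.QuantumManyBody.BoseGas.BoseEinsteinCondensation, imported by
Summits/AtomisticToContinuum/BoseEinsteinCondensation/Statement.lean itself (and by the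
auto-import), hence in the cone of EVERY route of this sub-problem and not planner-controllable; the
last is the conclusion of `closes`, none is a hypothesis of `closes` or referenced by any item, so
nothing is re-routed (0 imports dropped, 0 cruxes restated). Operator options if that census must be
silenced: exempt Statement-borne conjunct facts, or drop the three foreign Literature imports
(HardSphereEuler, FouriersLaw, Crystallization) from the sub Statement file, which only needs
QuantumManyBody.BoseEinsteinCondensation.

DEFINITION REQUESTS. None. All constants exist:
Literature.MathematicalPhysics.QuantumManyBody.BoseGas.{IsRepulsiveFiniteRange, PeriodicTrialState,
periodicEnergy, periodicGroundStateEnergy, cellOccupation, condensateOccupation, cell, cellN,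
sideLength, HasGroundStateBEC} (PeriodicBoseGas.lean / BoseEinsteinCondensation.lean),
Literature.Barriers.AtomisticToContinuum.BoseGas.periodicCondensateNumber
(KineticGapLengthScales.lean), _root_.BoseEinsteinCondensation (Statement.lean); `lean check` of
Sketch.lean rc 0, 0 sorries.

Novelty: Searches (2026-08-15): `lit frontier AtomisticToContinuum --since 2021` (30 rows; BEC descendants
arXiv:2510.20493, arXiv:2603.20776,
arXiv:2602.16566, arXiv:2605.06844 — localisation/energy, none RP); `lit search --source crossref
"infrared bounds quantum rotors long range order
ground state reflection positivity"` (10: doi:10.1016/j.physa.2012.06.028,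
doi:10.1016/s0034-4877(16)30019-2, doi:10.4171/90-1/5);
`lit search --source crossref "Bose Hubbard model Bose-Einstein condensation rigorous proof integer
filling superfluid infrared bound"` (9: only
doi:10.1063/5.0009128, NON-existence in d = 1, 2); `lit search --source crossref "… Stachura Pusz
Wojtkiewicz"` (same two); `lit search --hybrid
"quantum rotor reflection positivity infrared bound ground state long range order"` (vector leg
only, textbooks); `lit galaxy search "reflection
positivity Bose gas" --star all` (0 substring hits), `lit galaxy search --star pdf --mode bm25
"coarse-grained Bose gas reflection positivity"` (15,
none relevant); `lit read arxiv:1507.03079 --grep Hubbard` (p. 14, quoted in § Why this line);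
openalex HTTP 429, arxiv leg 0, searchd FTS leg
unavailable (rc 75) — recorded for the refuter re-run. Plus the five refuter audits on the card
(crossref "quantum rotor reflection positivity long
range order", "integer filling Bose-Hubbard infrared bound BEC proof": nothing regaining RP by
blocking).
Nearest prior art found: WojtkiewiczPuszStachura2016 = doi:10.1016/s0034-4877(16)30019-2 (rotor
RP/IR/LRO,  [refs: 10.1016/j.physa.2012.06.028, 10.1016/s0034-4877(16, 10.4171/90-1/5, 10.1063/5.0009128, 10.1103/physrevb.40.546, 2510.20493, 2603.20776, 2602.16566, 2605.06844, 1507.03079, doi:10.1016/j.physa.2012.06.028, doi:10.1016/s0034-4877, doi:10.4171/90-1/5, doi:10.1063/5.0009128, arxiv:1507.03079, doi:10.1103/physrevb.40.546, WojtkiewiczPuszStachura2016, FisherEtAl1989, AizenmanEtAl2004, LSSY2005, Corgini2]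

Barriers (technique_class: reflection-positivity infrared-bound block-localization): - technique_class: reflection-positivity infrared-bound block-localization
- Literature.Barriers.AtomisticToContinuum.HalfFillingReflectionPositivity: PARTLY evaded, PARTLY
inherited. Evaded: the reflection acts on BLOCK number–phase variables, Θ = (block reflection)∘(n_B
↦ 2m − n_B about the integer block filling m), under which the charging energy is even and cos(θ_B −
θ_B′) = cos⊗cos + sin⊗sin is the KLS real form the proved in-tree lemma
Matrix.kls_groundEnergy_reflection needs; blocking makes the filling a design parameter. Inherited:
RP is exact-or-nothing — the blocked gas carries the WPS2016 spoiler at relative size O(m^(-1/2)),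
isolated as the content of crux #2 (honest: no stability theory for GD exists; the bet is that a
susceptibility bound, unlike RP itself, survives a parametrically small spoiler).
- Literature.Barriers.AtomisticToContinuum.HalfFillingReflectionPositivityNarrow: its proved
rigidity (rp_oddCharge_eq_zero, hoppingRP_reflection_rigidity) APPLIES at block level and is not
evaded: Gaussian domination lives in the conjugation-charge-0 sector N = K³m only; the residue is
carried by the separate, mechanism-free crux FillingContinuity (state-level, not energetic), and the
glue FamilyToPeriodic needs it only for N − N′ < K³ ≤ √ρN/A³ particles.
- Literature.Barriers.AtomisticToContinuum.KineticGapLengthScales: the gap method is used only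
INSIDE blocks of legitimate side l ∈ [A, 2A]ρ^(-1/2) (crux #5, first-order precision suffices at
fixed A); inter-block c

History (route lifecycle, newest last):
- 2026-08-25T00:40:37Z · DORMANT — reconciler: no traction for 7.2 d (last activity item-evidence-added at 2026-08-17T18:55:01Z); parked, not closed — `ledger route dormant route-AtomisticToConti (operator:999:606894)
- 2026-08-26T00:55:10Z · REACTIVATED — reconciler: reactivated — activity item-evidence-added at 2026-08-25T20:00:16Z after parking at 2026-08-25T00:40:37Z (operator:999:515959)

sub-problem: BoseEinsteinCondensation · status: open · opened planner-plancard-AtomisticToContinuum-BoseEin-e1ccbd64-g2-0 2026-08-15T19:02:24Z · rev 3 · ledger route-AtomisticToContinuum-BECIntegerBlockRotor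
GENERATED by the gate from the ledger (D-0016/17). Provers cite these decls: `theorem foo : Summit.AtomisticToContinuum.BoseEinsteinCondensation.Theses.BECIntegerBlockRotor.<Decl> := …` in Summits/AtomisticToContinuum/BoseEinsteinCondensation/Theorems/<Name>.lean.
-/

namespace Summit.AtomisticToContinuum.BoseEinsteinCondensation.Theses.BECIntegerBlockRotor

open scoped BigOperators Topology Manifold Classical MeasureTheory ProbabilityTheory Matrix InnerProductSpace ComplexConjugate ContinuousMap
open Filter Set Function TopologicalSpace MeasureTheory

attribute [summit_statement] _root_.BoseEinsteinCondensation

/-- item stmt-AtomisticToContinuum-13591 · target · rank 0 · open · by planner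
why it might fail: False only if torus ground states at commensurate (N, L) fail to condense, i.e. if periodic BEC itself fails in the dilute regime; c uniform in ρ < ρ₀ is the KLS mode-counting shape (depletion into block waves ≤ C·I·√ρ₀·A⁻³·N).
sources: LSSY2005, KLS1988PRL, Fournais2020, WojtkiewiczPuszStachura2016
[target] BEC ALONG THE INTEGER-FILLED FAMILY, box-uniform: for every repulsive finite-range v there
are A, ρ₀, c > 0 and N₀ such that for every N ≥ N₀ and every torus side L > 0 with N ≤ ρ₀L³, if some
even K > 0 has K³ ∣ N and A/√(N/L³) ≤ L/K ≤ 2A/√(N/L³), then ofReal(cN) ≤ periodicCondensateNumber v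
N L (ground-state constant-mode occupation through near-minimisers,
Literature.Barriers.AtomisticToContinuum.BoseGas). Vacuous on boxes with no admissible K (e.g. N
prime) by design; FillingContinuity + FamilyToPeriodic upgrade it to all large N. -/
@[route_item "route-AtomisticToContinuum-BECIntegerBlockRotor"]
def FamilyBEC : Prop :=
  ∀ v : ℝ → ENNReal, Literature.MathematicalPhysics.QuantumManyBody.BoseGas.IsRepulsiveFiniteRange v → ∃ A : ℝ, 0 < A ∧ ∃ ρ₀ : ℝ, 0 < ρ₀ ∧ ∃ c : ℝ, 0 < c ∧ ∃ N₀ : ℕ, ∀ (N : ℕ) (L : ℝ), 0 < L → N₀ ≤ N → (N : ℝ) ≤ ρ₀ * L ^ 3 → (∃ K : ℕ, Even K ∧ 0 < K ∧ K ^ 3 ∣ N ∧ A / Real.sqrt ((N : ℝ) / L ^ 3) ≤ L / (K : ℝ) ∧ L / (K : ℝ) ≤ 2 * A / Real.sqrt ((N : ℝ) / L ^ 3)) → ENNReal.ofReal (c * N) ≤ Literature.Barriers.AtomisticToContinuum.BoseGas.periodicCondensateNumber v N L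

/-- item stmt-AtomisticToContinuum-13592 · crux · rank 2 · open · by planner
why it might fail: GD is exact-or-nothing (Speer1985): the blocked gas is the RP rotor array plus WPS2016's RP-spoiling term (√n amplitudes, floor n≥0, non-quadratic charging, Schur-complement couplings), small (O(m^-1/2)+(ξ/l)²) but no perturbative stability of GD is known.
sources: KLS1988JSP, DysonLiebSimon1978, WojtkiewiczPuszStachura2016, FisherEtAl1989, PasturKhoruzhenko1987, DriesslerLandauPerez1979
[crux] GAUSSIAN DOMINATION FOR THE BLOCKED GAS (card item "StateReduction", energy form; the
inter-block engine). There are ρ₀, A, C, N₀: for every box (N+1 ≤ ρ₀L³, N ≥ N₀), some δ > 0, every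
δ-near-minimiser Ψ of the periodic (N+1)-body energy, every even K > 0 with K³ ∣ N+1 and
A/√((N+1)/L³) ≤ L/K ≤ 2A/√((N+1)/L³), and every q ∈ ℤ³ with q ≢ 0 mod K: b₋(q) + b₊(q) ≤ C
(L/K)²/ε(q), ε(q) = Σ_j (1 − cos(2πq_j/K)), where b₋ = sup over N-particle Φ of |⟨Φ,
a(f_q)Ψ⟩|²/(E(Φ) − E₀(N) + θ), b₊ = sup over (N+2)-particle Φ of |⟨a(f_q)Φ, Ψ⟩|²/(E(Φ) − E₀(N+2) +
θ) (the two-sided static susceptibility of a(f_q) + a(f_q)*, = the resolvent expectations by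
Cauchy–Schwarz), f_q(x) = L^(-3/2) exp(2πi q·⌊Kx/L⌋/K) the block plane wave, θ = ε(q)/(L/K)² a
harmless regulariser; Bogoliubov value ≈ l²/(3ε(q)), free gas exactly l²·Σ_k|f̂_q(k)|²/(k²l²+ε(q)) ≤
l²/ε(q). MECHANISM: exact RP/GD of the integer-filled block rotor array (in tree:
QuantumRotorTruncatedGD, Matrix.kls_groundEnergy_reflection) + stability under the RP-spoiling
corrections. [difficulty: open-problem] -/
@[route_item "route-AtomisticToContinuum-BECIntegerBlockRotor"]
def BlockSusceptibilityBound : Prop :=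
  ∀ v : ℝ → ENNReal, Literature.MathematicalPhysics.QuantumManyBody.BoseGas.IsRepulsiveFiniteRange v → ∃ ρ₀ : ℝ, 0 < ρ₀ ∧ ∃ A : ℝ, 0 < A ∧ ∃ C : ℝ, 0 < C ∧ ∃ N₀ : ℕ, ∀ (N : ℕ) (L : ℝ), 0 < L → N₀ ≤ N → (N : ℝ) + 1 ≤ ρ₀ * L ^ 3 → ∃ δ : ENNReal, 0 < δ ∧ ∀ Ψ : Literature.MathematicalPhysics.QuantumManyBody.BoseGas.PeriodicTrialState (N + 1) L, Literature.MathematicalPhysics.QuantumManyBody.BoseGas.periodicEnergy v Ψ ≤ Literature.MathematicalPhysics.QuantumManyBody.BoseGas.periodicGroundStateEnergy v (N + 1) L + δ → ∀ K : ℕ, Even K → 0 < K → K ^ 3 ∣ (N + 1) → A / Real.sqrt (((N : ℝ) + 1) / L ^ 3) ≤ L / (K : ℝ) ∧ L / (K : ℝ) ≤ 2 * A / Real.sqrt (((N : ℝ) + 1) / L ^ 3) → ∀ q : Fin 3 → ℤ, ¬ (∀ j : Fin 3, (K : ℤ) ∣ q j) → (⨆ Φ : Literature.MathematicalPhysics.QuantumManyBody.BoseGas.PeriodicTrialState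 N L, ENNReal.ofReal (‖((Real.sqrt ((N : ℝ) + 1) : ℝ) : ℂ) * ∫ Y in Literature.MathematicalPhysics.QuantumManyBody.BoseGas.cellN N L, (starRingEnd ℂ) (Φ.ψ Y) * (∫ x in Literature.MathematicalPhysics.QuantumManyBody.BoseGas.cell L, (starRingEnd ℂ) ((((Real.sqrt (L ^ 3))⁻¹ : ℝ) : ℂ) * Complex.exp (((2 * Real.pi * (∑ j : Fin 3, (q j : ℝ) * (⌊(K : ℝ) * x j / L⌋ : ℝ)) / (K : ℝ) : ℝ) : ℂ) * Complex.I)) * Ψ.ψ (Matrix.vecCons x Y))‖ ^ 2) / (Literature.MathematicalPhysics.QuantumManyBody.BoseGas.periodicEnergy v Φ - Literature.MathematicalPhysics.QuantumManyBody.BoseGas.periodicGroundStateEnergy v N L + ENNReal.ofReal ((∑ j : Fin 3, (1 - Real.cos (2 * Real.pi * (q j : ℝ) / (K : ℝ)))) / ((L / (K : ℝ)) ^ 2)))) + (⨆ Φ : Literature.MathematicalPhysics.QuantumManyBody.BoseGas.PeriodicTrialState (N + 2) L, ENNReal.ofReal (‖((Real.sqrt ((N : ℝ) + 2) : ℝ)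 : ℂ) * ∫ Y in Literature.MathematicalPhysics.QuantumManyBody.BoseGas.cellN (N + 1) L, (starRingEnd ℂ) (∫ x in Literature.MathematicalPhysics.QuantumManyBody.BoseGas.cell L, (starRingEnd ℂ) ((((Real.sqrt (L ^ 3))⁻¹ : ℝ) : ℂ) * Complex.exp (((2 * Real.pi * (∑ j : Fin 3, (q j : ℝ) * (⌊(K : ℝ) * x j / L⌋ : ℝ)) / (K : ℝ) : ℝ) : ℂ) * Complex.I)) * Φ.ψ (Matrix.vecCons x Y)) * Ψ.ψ Y‖ ^ 2) / (Literature.MathematicalPhysics.QuantumManyBody.BoseGas.periodicEnergy v Φ - Literature.MathematicalPhysics.QuantumManyBody.BoseGas.periodicGroundStateEnergy v (N + 2) L + ENNReal.ofReal ((∑ j : Fin 3, (1 - Real.cos (2 * Real.pi * (q j : ℝ) / (K : ℝ)))) / ((L / (K : ℝ)) ^ 2)))) ≤ ENNReal.ofReal (C * (L / (K : ℝ)) ^ 2 / (∑ j : Fin 3, (1 - Real.cos (2 * Real.pi * (q j : ℝ) / (K : ℝ)))))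

/-- item stmt-AtomisticToContinuum-13593 · crux · rank 3 · open · by planner
why it might fail: Only if phase stiffness fails at the healing scale (susceptibility ≫ l²/ε(q), an anomalously soft non-phonon branch); as typed C must be uniform over all dilute boxes, K ≥ 2, hard cores, and absorb the O(1) aliasing of sharp block waves.
sources: KLS1988PRL, KLS1988JSP, LSSY2005, BjornbergUeltschi2022, WojtkiewiczPuszStachura2016
[crux] T = 0 INFRARED BOUND FOR BLOCK PLANE WAVES (Kennedy–Lieb–Shastry shape), box-uniform: there
are ρ₀, A, C, N₀ such that for every box (N ≥ N₀, N ≤ ρ₀L³), some δ > 0, every periodic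
δ-near-minimiser Ψ, every even K > 0 with K³ ∣ N and A/√(N/L³) ≤ L/K ≤ 2A/√(N/L³), and every q ≢ 0
mod K: ⟨f_q, γ_Ψ f_q⟩ = cellOccupation N L f_q Ψ ≤ C/√ε(q). Only the K³ coarse modes are constrained
(the low-momentum half); Bogoliubov predicts c₀(l/ξ)/√ε(q) + O(1) aliasing, l/ξ constant in ρ at
fixed A. From #2 by the KLS transfer (support KLSTransfer) or by any method. [deps:
BlockSusceptibilityBound] [difficulty: open-problem] -/
@[route_item "route-AtomisticToContinuum-BECIntegerBlockRotor", crux]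
def BlockInfraredBound : Prop :=
  ∀ v : ℝ → ENNReal, Literature.MathematicalPhysics.QuantumManyBody.BoseGas.IsRepulsiveFiniteRange v → ∃ ρ₀ : ℝ, 0 < ρ₀ ∧ ∃ A : ℝ, 0 < A ∧ ∃ C : ℝ, 0 < C ∧ ∃ N₀ : ℕ, ∀ (N : ℕ) (L : ℝ), 0 < L → N₀ ≤ N → (N : ℝ) ≤ ρ₀ * L ^ 3 → ∃ δ : ENNReal, 0 < δ ∧ ∀ Ψ : Literature.MathematicalPhysics.QuantumManyBody.BoseGas.PeriodicTrialState N L, Literature.MathematicalPhysics.QuantumManyBody.BoseGas.periodicEnergy v Ψ ≤ Literature.MathematicalPhysics.QuantumManyBody.BoseGas.periodicGroundStateEnergy v N L + δ → ∀ K : ℕ, Even K → 0 < K → K ^ 3 ∣ N → A / Real.sqrt ((N : ℝ) / L ^ 3) ≤ L / (K : ℝ) ∧ L / (K : ℝ) ≤ 2 * A / Real.sqrt ((N : ℝ) / L ^ 3) → ∀ q : Fin 3 → ℤ, ¬ (∀ j : Fin 3, (K : ℤ) ∣ q j) → Literature.MathematicalPhysics.QuantumManyBody.BoseGas.cellOccupation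 N L (fun x : EuclideanSpace ℝ (Fin 3) => (((Real.sqrt (L ^ 3))⁻¹ : ℝ) : ℂ) * Complex.exp (((2 * Real.pi * (∑ j : Fin 3, (q j : ℝ) * (⌊(K : ℝ) * x j / L⌋ : ℝ)) / (K : ℝ) : ℝ) : ℂ) * Complex.I)) Ψ.ψ ≤ ENNReal.ofReal (C / Real.sqrt (∑ j : Fin 3, (1 - Real.cos (2 * Real.pi * (q j : ℝ) / (K : ℝ)))))

/-- item stmt-AtomisticToContinuum-13594 · crux · rank 4 · open · by planner
why it might fail: A ground-state-to-ground-state comparison across N with no variational handle: energy slack (N−N′)·8πaρ ≫ N/L² rules out energy proofs (Galilei boost), GD is lost off charge 0, and C uniform down to N′ ~ 1, L ≫ healing length includes the polaron regime.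
sources: LSSY2005, KLS1988JSP, MysliwySeiringer2020, AizenmanEtAl2004, Literature.Barriers.AtomisticToContinuum.KineticGapLengthScalesNarrow
[crux] QUASI-MONOTONICITY OF THE CONDENSATE IN THE PARTICLE NUMBER ON A FIXED TORUS (replaces gen-1
FillingRemainder; the doping step every RP mechanism needs, since RP reaches only
conjugation-charge-0 sectors, rp_oddCharge_eq_zero): for every repulsive finite-range v there are C
≥ 0 and ρ₁ > 0 such that for all N′ ≤ N and L > 0 with N ≤ ρ₁L³: periodicCondensateNumber v N′ L ≤
periodicCondensateNumber v N L + C(N − N′) — adding a particle to a dilute periodic box removes at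
most C particles from the ground-state condensate (Bogoliubov: it ADDS 1 − O(√(ρa³))). Weaker than
BEC (true when nothing condenses), mechanism-free, box-uniform; the impurity/induction technology of
card one-particle-at-a-time (MysliwySeiringer2020-type dressing, retired route
BECParticleInduction's IncrementBound is the Dirichlet '+1/2' strengthening) is the foreseen engine.
[difficulty: open-problem] -/
@[route_item "route-AtomisticToContinuum-BECIntegerBlockRotor", crux]
def FillingContinuity : Prop :=
  ∀ v : ℝ → ENNReal, Literature.MathematicalPhysics.QuantumManyBody.BoseGas.IsRepulsiveFiniteRange v → ∃ C : ℝ, 0 ≤ C ∧ ∃ ρ₁ : ℝ, 0 < ρ₁ ∧ ∀ (N' N : ℕ) (L : ℝ), 0 < L → N' ≤ N → (N : ℝ) ≤ ρ₁ * L ^ 3 → Literature.Barriers.AtomisticToContinuum.BoseGas.periodicCondensateNumber v N' L ≤ Literature.Barriers.AtomisticToContinuum.BoseGas.periodicCondensateNumber v N L + ENNReal.ofReal (C * ((N : ℝ) - (N' : ℝ)))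

/-- item stmt-AtomisticToContinuum-13595 · crux · rank 5 · closed · proved by Summit.AtomisticToContinuum.BoseEinsteinCondensation.Theorems.BlockCondensation.blockCondensation_proof (prover) · by planner
why it might fail: Thm 2.4's per-block hypotheses (Y_B < δ, l/a > C′Y_B^(-6/17)) fail for under/over-filled blocks (capping + monotonicity of E^Neu in n needed); δ must serve all K in the window at once; hard cores v = ⊤; K = 2 boxes.
sources: LSSY2005, Fournais2020, Junge2026, ChongLiangNam2026
[crux] INTRA-BLOCK BEC SUMMED OVER BLOCKS (the ultraviolet half; sum-rule side of KLS), box-uniform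
and with NO integer-filling hypothesis: for every A > 0 and η > 0 there are ρ₀, N₀ such that for
every box (N ≥ N₀, N ≤ ρ₀L³), some δ > 0, every periodic δ-near-minimiser Ψ and every even K > 0
with A/√(N/L³) ≤ L/K ≤ 2A/√(N/L³): Σ_B ⟨u_B, γ_Ψ u_B⟩ ≥ (1 − η)N for the normalised block indicators
u_B = (L/K)^(-3/2) 1_(⌊Kx/L⌋ = B). Route to proof, inputs PROVED in tree: Neumann bracketing of the
torus into K³ blocks (v ≥ 0 drops cross pairs), per-block LSSY Thm 2.4 lower bound with capping for
under/over-filled blocks, global Thm 2.2 upper bound, Jensen on Σ n_B², and the gap step of LSSY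
Lemma 5.2 inside each block: depletion ≤ C A² a (Y^(1/17) + a/b) N → 0 at fixed A. [difficulty: L] -/
@[route_item "route-AtomisticToContinuum-BECIntegerBlockRotor", crux]
def BlockCondensation : Prop :=
  ∀ v : ℝ → ENNReal, Literature.MathematicalPhysics.QuantumManyBody.BoseGas.IsRepulsiveFiniteRange v → ∀ A : ℝ, 0 < A → ∀ η : ℝ, 0 < η → ∃ ρ₀ : ℝ, 0 < ρ₀ ∧ ∃ N₀ : ℕ, ∀ (N : ℕ) (L : ℝ), 0 < L → N₀ ≤ N → (N : ℝ) ≤ ρ₀ * L ^ 3 → ∃ δ : ENNReal, 0 < δ ∧ ∀ Ψ : Literature.MathematicalPhysics.QuantumManyBody.BoseGas.PeriodicTrialState N L, Literature.MathematicalPhysics.QuantumManyBody.BoseGas.periodicEnergy v Ψ ≤ Literature.MathematicalPhysics.QuantumManyBody.BoseGas.periodicGroundStateEnergy v N L + δ → ∀ K : ℕ, Even K → 0 < K → A / Real.sqrt ((N : ℝ) / L ^ 3) ≤ L / (K : ℝ) ∧ L / (K : ℝ) ≤ 2 * A / Real.sqrt ((N : ℝ) / L ^ 3) → ENNReal.ofReal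 ((1 - η) * N) ≤ ∑ B : Fin 3 → Fin K, Literature.MathematicalPhysics.QuantumManyBody.BoseGas.cellOccupation N L (fun x : EuclideanSpace ℝ (Fin 3) => if (∀ j : Fin 3, ⌊(K : ℝ) * x j / L⌋ = (((B j : Fin K) : ℕ) : ℤ)) then ((((Real.sqrt ((L / (K : ℝ)) ^ 3))⁻¹ : ℝ) : ℂ)) else 0) Ψ.ψ

-- `BlockCondensation` holds: proved by `Summit.AtomisticToContinuum.BoseEinsteinCondensation.Theorems.BlockCondensation.blockCondensation_proof` (its module imports this route file, so no `_holds` link can be stated here).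

/-- item stmt-AtomisticToContinuum-0827 · crux · rank 6 · open · by planner
why it might fail: PeriodicBEC is ground-state-only (δ after N): the Dirichlet ground state is a periodic trial state but lies a wall term ≫ δ above E₀^per; interior restrictions are neither periodic nor of sharp N; BEC is BC-sensitive (Robinson1976).
sources: LSSY2005, Robinson1976 = doi:10.1007/bf01608554, Junge2026 = arXiv:2603.20776 Thm 3, stmt-AtomisticToContinuum-0827 (home: route-AtomisticToContinuum-BECPeriodicReduction)
[crux] BoundaryTransferWeak (mode-free boundary-condition transfer, per potential): for each
repulsive finite-range v, PeriodicBEC(v) implies ∃ρ₀>0 ∀ρ∈(0,ρ₀) HasGroundStateBEC v ρ (Dirichlet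
ground state, λ_max(γ) ≥ cN via condensateNumber). Not glue: near-minimiser slacks are O(N/L²) while
Dirichlet/periodic energies differ by a boundary term ≫ N/L², so no energy-comparison proof;
expected route: Neumann bracketing of interior sub-boxes (−Δ_Dir ≥ ⊕−Δ_Neu, v ≥ 0) + a mode-free
criterion (λ_max ≥ tr γ²/N). Only the ENERGY analogue is in print (LiebSeiringerSolovejYngvason2005
Ch. 2 after (2.8)). v ≡ 0: hypothesis and conclusion both true. -/
@[route_item "route-AtomisticToContinuum-BECIntegerBlockRotor", crux]
def BoundaryTransferWeak : Prop :=
  ∀ v : ℝ → ENNReal, Literature.MathematicalPhysics.QuantumManyBody.BoseGas.IsRepulsiveFiniteRange v → (∃ ρ₀ : ℝ, 0 < ρ₀ ∧ ∀ ρ : ℝ, 0 < ρ → ρ < ρ₀ → ∃ c : ℝ, 0 < c ∧ ∀ᶠ N : ℕ in Filter.atTop, ∃ δ : ENNReal, 0 < δ ∧ ∀ Ψ : Literature.MathematicalPhysics.QuantumManyBody.BoseGas.PeriodicTrialState N (Literature.MathematicalPhysics.QuantumManyBody.BoseGas.sideLength ρ N), Literature.MathematicalPhysics.QuantumManyBody.BoseGas.periodicEnergy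 v Ψ ≤ Literature.MathematicalPhysics.QuantumManyBody.BoseGas.periodicGroundStateEnergy v N (Literature.MathematicalPhysics.QuantumManyBody.BoseGas.sideLength ρ N) + δ → ENNReal.ofReal (c * N) ≤ Literature.MathematicalPhysics.QuantumManyBody.BoseGas.condensateOccupation N (Literature.MathematicalPhysics.QuantumManyBody.BoseGas.sideLength ρ N) Ψ.ψ) → ∃ ρ₀ : ℝ, 0 < ρ₀ ∧ ∀ ρ : ℝ, 0 < ρ → ρ < ρ₀ → Literature.MathematicalPhysics.QuantumManyBody.BoseGas.HasGroundStateBEC v ρ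

/-- item stmt-AtomisticToContinuum-13596 · support · rank 9 · open · by planner
sources: KLS1988JSP, KLS1988PRL, LSSY2005
[support] BlockSusceptibilityBound → BlockInfraredBound, the canonical fixed-N Kennedy–Lieb–Shastry
transfer: 2n(f) + 1 = ‖a(f)Ψ‖² + ‖a(f)*Ψ‖² ≤ √((b₋ + b₊)(c₋ + c₊)) (spectral Cauchy–Schwarz with
sector-wise reference energies E₀(N∓1)), c = double commutator ⟨[a(f)*, [H, a(f)]]⟩ ≤ ⟨f, −Δf⟩ +
interaction part + concavity defect (2E₀(N) − E₀(N−1) − E₀(N+1))₊ ≤ c√(ρ/a) (trivial for integrable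
v via the constant one-particle trial state, Jastrow insertion for hard cores). Sharp block waves
have ⟨f, −Δf⟩ = ∞: smooth at relative scale s (cost 1/s in c) and return to the sharp wave through
translation invariance of near-ground states (γ diagonal in plane waves, n(f) = Σ_k |f̂(k)|² n_k;
layer mode of norm² ~ s); regulariser θ = ε(q)/l² costs O(1) per mode ≪ m. Apply #2 with its N := N
− 1. [difficulty: L] -/
@[route_item "route-AtomisticToContinuum-BECIntegerBlockRotor"]
def KLSTransfer : Prop :=
  BlockSusceptibilityBound → BlockInfraredBound

/-- item stmt-AtomisticToContinuum-13597 · support · rank 9 · closed · proved by Summit.AtomisticToContinuum.BoseEinsteinCondensation.Theorems.BECIntegerBlockRotorBlockModeCounting.blockModeCounting_proof (prover) · by planner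
sources: KLS1988PRL, LSSY2005, WojtkiewiczPuszStachura2016
[support] BlockInfraredBound → BlockCondensation → FamilyBEC (mode counting, the d = 3 step): with
A, C from #3 and η = 1/4 in #5: (i) Parseval on the K³-dimensional span of the block indicators,
Σ_(q mod K) n(f_q) = Σ_B n(u_B) (f_q = K^(-3/2) Σ_B e^(2πiq·B/K) u_B is an orthonormal basis;
occupation is a quadratic form in the mode, Fubini); (ii) f_0·1_cell = constantMode L, so n(f_0) =
condensateOccupation; (iii) Σ_(q≠0) n(f_q) ≤ C K³ I, I = sup_K K^(-3) Σ_(q≠0) ε(q)^(-1/2) < ∞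
(Riemann sum of (2π)^(-3)∫dq ε^(-1/2), the WPS2016 constant 𝓘₃ ≈ 0.644; cf. in-tree klsRiemannSum
facts); (iv) K³ = N/m ≤ N√(N/L³)/A³ ≤ √ρ₀ N/A³, so Σ_(q≠0) ≤ N/4 once ρ₀ ≤ (A³/4CI)²; hence n(f_0) ≥
N/2 on δ-near-minimisers (δ = min of the two), and le_periodicCondensateNumber gives FamilyBEC with
c = 1/2, N₀ = max; (v) ENNReal bookkeeping. [difficulty: M] -/
@[route_item "route-AtomisticToContinuum-BECIntegerBlockRotor", crux]
def BlockModeCounting : Prop :=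
  BlockInfraredBound → BlockCondensation → FamilyBEC

-- `BlockModeCounting` holds: proved by `Summit.AtomisticToContinuum.BoseEinsteinCondensation.Theorems.BECIntegerBlockRotorBlockModeCounting.blockModeCounting_proof` (its module imports this route file, so no `_holds` link can be stated here).

/-- item stmt-AtomisticToContinuum-13598 · support · rank 9 · closed · proved by Summit.AtomisticToContinuum.BoseEinsteinCondensation.Theorems.BECIntegerBlockRotorFamilyToPeriodic.familyToPeriodic_proof (prover) · by planner
sources: LSSY2005, Literature.Barriers.AtomisticToContinuum.KineticGapLengthScales
[support] FamilyBEC → FillingContinuity → PeriodicBEC for every repulsive finite-range v (the exact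
antecedent of BoundaryTransferWeak): given v take (A, ρ₀ᶠ, c, N₀) and (C, ρ₁); for ρ < ρ₀ :=
min(ρ₀ᶠ, ρ₁, ρ*) and large N put L = (N/ρ)^(1/3), pick an even K in [L√ρ/(1.8A), L√ρ/(1.2A)] (length
≥ 2 for large N) and N′ := K³⌊N/K³⌋: then K³ ∣ N′, N − N′ < K³ ≤ √ρ N/(1.728A³), N′/L³ ∈ [0.99ρ, ρ]
so A/√(N′/L³) ≤ L/K ≤ 2A/√(N′/L³); FamilyBEC gives ofReal(cN′) ≤ PCN(N′, L), FillingContinuity gives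
PCN(N′, L) ≤ PCN(N, L) + ofReal(C(N − N′)) with C(N − N′) ≤ cN′/2 once m′ = N′/K³ ≥ 1.728A³/√ρ − 1 ≥
2C/c (this fixes ρ*); so PCN(N, L) ≥ ofReal(cN/4) > ofReal(cN/8) and lt_iSup_iff unpacks
periodicCondensateNumber into ∃δ > 0 ∀Ψ δ-near-minimiser, ofReal((c/8)N) ≤ condensateOccupation.
Real arithmetic (floor, rpow, even integer in an interval of length ≥ 2) + ENNReal; provable now.
[difficulty: provable-now] -/
@[route_item "route-AtomisticToContinuum-BECIntegerBlockRotor", crux (experiment := "instrument: Influence `Assembly` 19:18–19:20Z; BEC items 13595 `BlockCondensation` (`…BoseEinsteinCondensation.Theorems.BlockCondensation.blockCondensa…") (source := "director FRONTIER l.36, 2026-09-01")]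
def FamilyToPeriodic : Prop :=
  FamilyBEC → FillingContinuity → ∀ v : ℝ → ENNReal, Literature.MathematicalPhysics.QuantumManyBody.BoseGas.IsRepulsiveFiniteRange v → ∃ ρ₀ : ℝ, 0 < ρ₀ ∧ ∀ ρ : ℝ, 0 < ρ → ρ < ρ₀ → ∃ c : ℝ, 0 < c ∧ ∀ᶠ N : ℕ in Filter.atTop, ∃ δ : ENNReal, 0 < δ ∧ ∀ Ψ : Literature.MathematicalPhysics.QuantumManyBody.BoseGas.PeriodicTrialState N (Literature.MathematicalPhysics.QuantumManyBody.BoseGas.sideLength ρ N), Literature.MathematicalPhysics.QuantumManyBody.BoseGas.periodicEnergy v Ψ ≤ Literature.MathematicalPhysics.QuantumManyBody.BoseGas.periodicGroundStateEnergy v N (Literature.MathematicalPhysics.QuantumManyBody.BoseGas.sideLength ρ N) + δ → ENNReal.ofReal (c * N) ≤ Literature.MathematicalPhysics.QuantumManyBody.BoseGas.condensateOccupation N (Literature.MathematicalPhysics.QuantumManyBody.BoseGas.sideLength ρ N) Ψ.ψ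

-- `FamilyToPeriodic` holds: proved by `Summit.AtomisticToContinuum.BoseEinsteinCondensation.Theorems.BECIntegerBlockRotorFamilyToPeriodic.familyToPeriodic_proof` (its module imports this route file, so no `_holds` link can be stated here).

/-- item stmt-AtomisticToContinuum-13599 · assembly · rank 1 · open · by planner
sources: LSSY2005, KLS1988PRL
[assembly] BlockModeCounting → BlockInfraredBound → BlockCondensation → FillingContinuity →
FamilyToPeriodic → BoundaryTransferWeak → BoseEinsteinCondensation (the sub-problem Statement decl). -/
@[route_item "route-AtomisticToContinuum-BECIntegerBlockRotor"]
def Assembly : Prop :=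
  BlockModeCounting → BlockInfraredBound → BlockCondensation → FillingContinuity → FamilyToPeriodic → BoundaryTransferWeak → _root_.BoseEinsteinCondensation

/-! D-0027 §2.1 — DECIDING THEOREM (planner-authored via `route open/edit --closes-file`; by planner-plancard-AtomisticToContinuum-BoseEin-e1ccbd64-g2-0 2026-08-15T19:02:24Z):
its hypotheses are this route's items and its conclusion the sub-problem Statement (glue_lint), and it elaborates with this file. -/

@[closes "route-AtomisticToContinuum-BECIntegerBlockRotor"] theorem closes (hMC : BlockModeCounting) (hIR : BlockInfraredBound) (hBC : BlockCondensation) (hFC : FillingContinuity) (hFP : FamilyToPeriodic) (hBT : BoundaryTransferWeak) : _root_.BoseEinsteinCondensation :=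
  fun v hv => hBT v hv (hFP (hMC hIR hBC) hFC v hv)

end Summit.AtomisticToContinuum.BoseEinsteinCondensation.Theses.BECIntegerBlockRotor
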